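import Mathlib.Analysis.SpecialFunctions.Pow.Real
import Mathlib.Tactic.Linarith
import Mathlib.Tactic.Positivity
import Mathlib.Tactic.Ring
import HarnessLib

/-!
# `NoHeavyLowerTail` (stmt-CriticalPhenomena-4575) — the PROFILE row APL-P: `P(a|b|c)³ ≤ P(a∤bc)·(P(b∤ac)·P(c∤ab))^{3/2}`
# implies APL(2/3), is preserved by piece-union at the apex, and holds for hubs (algebraic core)

Support file (prover seat `prim-ineq-gen-8`, gen 31; `--supports stmt-CriticalPhenomena-4575`; memo
`run/shared/lean/prim/prim-ineq-gen-8/FINDING-gen31-APL-PROFILE.md` §5).  Pure real algebra, no definitions, no named facts, no sorries.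

CONTEXT.  Cells of three vertices `a, b, c` of a finite weighted graph: `u0 = P(a|b|c)`, `uab = P(ab|c)`, `uac = P(ac|b)`,
`ubc = P(a|bc)`, `u3 = P(abc)` (nonnegative, sum `1`); `e = uab + uac`, `D = P(b ↮ c) = u0 + e`, `T = P(a ↔ {b,c}) = e + u3`;
isolation probabilities `isoA = P(a ∤ {b,c}) = u0 + ubc = 1 − T`, `isoB = P(b ∤ {a,c}) = u0 + uac`, `isoC = P(c ∤ {a,b}) = u0 + uab`.
The lineage's conjectured reverse-Harris row is APL(2/3): `2·D·T ≤ 3e` (prove-5 g35; gen-29 file `…APLGeometricClosure`: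
`apl23_of_geom`).  Gen 31 (memo §5) proposes the PROFILE row
  **APL-P:  u0³ ≤ isoA · (isoB · isoC)^{3/2}**,  polynomially  `u0⁶ ≤ isoA² · (isoB · isoC)³`,
which in the symmetric case `uab = uac` is exactly the Poisson hub-tree envelope `ρ_G ≤ 1 − s²(2 − s)` of g35 §3 (tight along the whole
extremal hierarchy, not only in its sparse limit), and which cuts the abstract four-point violators that survive every published row (memo §3–§4).
In the apex 4-tuple `(A_B, A_C, A_0, N_0) = (isoB/D, isoC/D, u0/D, 1 − T)` of gen 29 §1 it reads `A_0³ ≤ N_0 (A_B A_C)^{3/2}`, a monomial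
inequality in quantities that are MULTIPLICATIVE over the pieces at `a`; this file records the three algebraic facts used in memo §5:
* `APL.apl23_of_profile_cells` — APL-P ⟹ APL(2/3):  `u0⁶ ≤ (u0+ubc)²((u0+uab)(u0+uac))³ ⟹ 2·D·T ≤ 3e`; proof:
  `(u0+uab)(u0+uac) ≤ (u0+e/2)²`, hence `u0³ ≤ (1−T)(u0+e/2)³`, and the identity `u0³·D = (u0 − e/2)(u0+e/2)³ + (e/2)³(2u0+e/2)`
  (normalised: `(1−Q)³ − (1−3Q/2)(1−Q/2)³ = (Q/2)³(2−3Q/2) ≥ 0`);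
* `APL.profile_mul` — the product of two 4-tuples satisfying `A_0⁶ ≤ N_0²(A_B A_C)³` satisfies it (THEOREM A_P, piece-union closure, memo §5(b));
* `APL.profile_hub` — the single hub `{h; h–b = x, h–c = w}` glued at the apex satisfies APL-P:
  `((1−x)(1−w))⁶ ≤ ((1−x)(1−w))²·((1−x)·(1−w))³·((1−x)(1−w))^{…}` i.e. `u0⁶ ≤ isoA²(isoB isoC)³` with `u0 = isoA = (1−x)(1−w)`,
  `isoB = 1−x`, `isoC = 1−w`.
The remaining step of COROLLARY B_P (APL-P on forests) — pendant scaling `(qB,qC,r) ↦ z·(qB,qC,r)` preserves the row — is proved on paper in memo §5(b)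
(convexity of `z ↦ (1−zQ)³((1−zqB)(1−zqC))^{−3/2}`) and is not formalised here.  [this work]
-/

namespace Summit.CriticalPhenomena.PercolationContinuityZ3.Theorems

namespace APL

set_option maxHeartbeats 400000 in
/-- **APL-P ⟹ APL(2/3), cell form.**  With nonnegative cells `u0, uab, uac, ubc, u3` summing to `1`,
`e = uab + uac`, `D = u0 + e`, `T = e + u3`: if `u0⁶ ≤ (u0+ubc)²·((u0+uab)(u0+uac))³` (APL-P, squared) then `2·D·T ≤ 3e`
(APL(2/3); `u3 ≥ 0` is not needed).  `(u0+uab)(u0+uac) ≤ (u0+e/2)²`, so `u0³ ≤ (1−T)(u0+e/2)³`, and the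
identity `u0³·D = (u0 − e/2)(u0 + e/2)³ + (e/2)³(2u0 + e/2)` gives `u0 − e/2 ≤ D(1−T)`, i.e. `D·T ≤ 3e/2`. [this work] -/
theorem apl23_of_profile_cells (u0 uab uac ubc u3 : ℝ) (h0 : 0 ≤ u0) (hab : 0 ≤ uab) (hac : 0 ≤ uac)
    (hbc : 0 ≤ ubc) (hsum : u0 + uab + uac + ubc + u3 = 1)
    (h : u0 ^ 6 ≤ (u0 + ubc) ^ 2 * ((u0 + uab) * (u0 + uac)) ^ 3) :
    2 * ((u0 + uab + uac) * (uab + uac + u3)) ≤ 3 * (uab + uac) := by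
  have he0 : 0 ≤ uab + uac := by positivity
  have hm0 : 0 ≤ u0 + (uab + uac) / 2 := by positivity
  -- AM–GM on the two isolation factors
  have hprod : (u0 + uab) * (u0 + uac) ≤ (u0 + (uab + uac) / 2) ^ 2 := by nlinarith [sq_nonneg (uab - uac)]
  have hprod0 : 0 ≤ (u0 + uab) * (u0 + uac) := by positivity
  have h1 : u0 ^ 6 ≤ (u0 + ubc) ^ 2 * (u0 + (uab + uac) / 2) ^ 6 := by
    have hp3 : ((u0 + uab) * (u0 + uac)) ^ 3 ≤ ((u0 + (uab + uac) / 2) ^ 2) ^ 3 :=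
      pow_le_pow_left₀ hprod0 hprod 3
    calc u0 ^ 6 ≤ (u0 + ubc) ^ 2 * ((u0 + uab) * (u0 + uac)) ^ 3 := h
      _ ≤ (u0 + ubc) ^ 2 * ((u0 + (uab + uac) / 2) ^ 2) ^ 3 := mul_le_mul_of_nonneg_left hp3 (sq_nonneg _)
      _ = (u0 + ubc) ^ 2 * (u0 + (uab + uac) / 2) ^ 6 := by ring
  -- square root: u0^3 ≤ (u0+ubc) m^3
  have h2 : u0 ^ 3 ≤ (u0 + ubc) * (u0 + (uab + uac) / 2) ^ 3 := by
    have ha : 0 ≤ u0 ^ 3 := pow_nonneg h0 3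
    have hb : 0 ≤ (u0 + ubc) * (u0 + (uab + uac) / 2) ^ 3 := mul_nonneg (by positivity) (pow_nonneg hm0 3)
    have hsq : (u0 ^ 3) ^ 2 ≤ ((u0 + ubc) * (u0 + (uab + uac) / 2) ^ 3) ^ 2 := by
      calc (u0 ^ 3) ^ 2 = u0 ^ 6 := by ring
        _ ≤ (u0 + ubc) ^ 2 * (u0 + (uab + uac) / 2) ^ 6 := h1
        _ = ((u0 + ubc) * (u0 + (uab + uac) / 2) ^ 3) ^ 2 := by ring
    by_contra hlt
    have hlt' := lt_of_not_ge hlt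
    have := mul_self_lt_mul_self hb hlt'
    nlinarith [this, hsq]
  -- the identity u0^3 D = (u0 - e/2) m^3 + (e/2)^3 (2 u0 + e/2)
  have hid : u0 ^ 3 * (u0 + (uab + uac)) =
      (u0 - (uab + uac) / 2) * (u0 + (uab + uac) / 2) ^ 3 + ((uab + uac) / 2) ^ 3 * (2 * u0 + (uab + uac) / 2) := by
    ring
  have hrest : 0 ≤ ((uab + uac) / 2) ^ 3 * (2 * u0 + (uab + uac) / 2) := by positivity
  have hD0 : 0 ≤ u0 + (uab + uac) := by positivity
  -- (u0 - e/2) m^3 ≤ u0^3 D ≤ D (u0+ubc) m^3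
  have h4 : (u0 - (uab + uac) / 2) * (u0 + (uab + uac) / 2) ^ 3 ≤
      (u0 + (uab + uac)) * (u0 + ubc) * (u0 + (uab + uac) / 2) ^ 3 := by
    have h2' : (u0 + (uab + uac)) * u0 ^ 3 ≤ (u0 + (uab + uac)) * ((u0 + ubc) * (u0 + (uab + uac) / 2) ^ 3) :=
      mul_le_mul_of_nonneg_left h2 hD0
    have e1 : (u0 - (uab + uac) / 2) * (u0 + (uab + uac) / 2) ^ 3 =
        u0 ^ 3 * (u0 + (uab + uac)) - ((uab + uac) / 2) ^ 3 * (2 * u0 + (uab + uac) / 2) := by linarith [hid]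
    have e2 : (u0 + (uab + uac)) * ((u0 + ubc) * (u0 + (uab + uac) / 2) ^ 3) =
        (u0 + (uab + uac)) * (u0 + ubc) * (u0 + (uab + uac) / 2) ^ 3 := by ring
    have e3 : u0 ^ 3 * (u0 + (uab + uac)) = (u0 + (uab + uac)) * u0 ^ 3 := by ring
    linarith [h2', hrest, e1, e2, e3]
  rcases eq_or_lt_of_le hm0 with hmz | hmpos
  · -- m = 0: then u0 = uab = uac = 0 and both sides vanish
    have hz : u0 + uab + uac = 0 := by linarith
    rw [hz, zero_mul, mul_zero]
    linarith [he0]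
  · have hm3 : 0 < (u0 + (uab + uac) / 2) ^ 3 := pow_pos hmpos 3
    have h5 : u0 - (uab + uac) / 2 ≤ (u0 + (uab + uac)) * (u0 + ubc) := by
      have h4' : (u0 - (uab + uac) / 2) * (u0 + (uab + uac) / 2) ^ 3 ≤
          ((u0 + (uab + uac)) * (u0 + ubc)) * (u0 + (uab + uac) / 2) ^ 3 := by linarith [h4]
      exact le_of_mul_le_mul_right h4' hm3
    -- u0 + ubc = 1 - T with T = uab + uac + u3
    have hT : u0 + ubc = 1 - (uab + uac + u3) := by linarith
    rw [hT] at h5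
    -- h5 : u0 - e/2 ≤ D (1 - T); conclude 2 D T ≤ 3 e since D - u0 = e
    have hexp : (u0 + (uab + uac)) * (1 - (uab + uac + u3)) =
        (u0 + (uab + uac)) - (u0 + (uab + uac)) * (uab + uac + u3) := by ring
    rw [hexp] at h5
    have hgoal : (u0 + (uab + uac)) * (uab + uac + u3) ≤ 3 / 2 * (uab + uac) := by linarith [h5]
    have hD : u0 + uab + uac = u0 + (uab + uac) := by ring
    rw [hD]
    linarith [hgoal]

/-- **THEOREM A_P, algebraic core (piece-union closure of APL-P).**  If two apex 4-tuples satisfy the squared profile row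
`A_0⁶ ≤ N_0²·(A_B·A_C)³` (with `A_0 ≥ 0`) then so does their coordinatewise product — the 4-tuple of a union of
pieces at the apex is the product of the piece tuples (gen 29 §1). [this work] -/
theorem profile_mul (aB aC a0 n bB bC b0 m : ℝ) (ha0 : 0 ≤ a0) (hb0 : 0 ≤ b0)
    (ha : a0 ^ 6 ≤ n ^ 2 * (aB * aC) ^ 3) (hb : b0 ^ 6 ≤ m ^ 2 * (bB * bC) ^ 3) :
    (a0 * b0) ^ 6 ≤ (n * m) ^ 2 * ((aB * bB) * (aC * bC)) ^ 3 := by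
  have h1 : (a0 * b0) ^ 6 = a0 ^ 6 * b0 ^ 6 := by ring
  have h2 : (n * m) ^ 2 * ((aB * bB) * (aC * bC)) ^ 3 = (n ^ 2 * (aB * aC) ^ 3) * (m ^ 2 * (bB * bC) ^ 3) := by ring
  rw [h1, h2]
  exact mul_le_mul ha hb (pow_nonneg hb0 6) (le_trans (pow_nonneg ha0 6) ha)

/-- **The hub satisfies APL-P.**  For the single hub `h` glued at the apex with `h–b`, `h–c` edge weights `x, w ∈ [0,1]`:
`u0 = (1−x)(1−w)`, `uab = x(1−w)`, `uac = w(1−x)`, `ubc = 0`, so `isoA = u0`, `isoB = 1−x`, `isoC = 1−w` and the squared row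
`u0⁶ ≤ isoA²(isoB·isoC)³ = u0⁵` holds (strictly unless `u0 ∈ {0,1}`). [this work] -/
theorem profile_hub (x w : ℝ) (hx0 : 0 ≤ x) (hx1 : x ≤ 1) (hw0 : 0 ≤ w) (hw1 : w ≤ 1) :
    ((1 - x) * (1 - w)) ^ 6 ≤ ((1 - x) * (1 - w) + 0) ^ 2 * (((1 - x) * (1 - w) + w * (1 - x)) * ((1 - x) * (1 - w) + x * (1 - w))) ^ 3 := by
  have hu : 0 ≤ (1 - x) * (1 - w) := mul_nonneg (by linarith) (by linarith)
  have hu1 : (1 - x) * (1 - w) ≤ 1 := by nlinarith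
  have e1 : (1 - x) * (1 - w) + w * (1 - x) = 1 - x := by ring
  have e2 : (1 - x) * (1 - w) + x * (1 - w) = 1 - w := by ring
  rw [add_zero, e1, e2]
  -- u^6 ≤ u^2 * u^3 = u^5 since u ≤ 1
  calc ((1 - x) * (1 - w)) ^ 6 = ((1 - x) * (1 - w)) ^ 5 * ((1 - x) * (1 - w)) := by ring
    _ ≤ ((1 - x) * (1 - w)) ^ 5 * 1 := mul_le_mul_of_nonneg_left hu1 (pow_nonneg hu 5)
    _ = ((1 - x) * (1 - w)) ^ 2 * ((1 - x) * (1 - w)) ^ 3 := by ring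

end APL

end Summit.CriticalPhenomena.PercolationContinuityZ3.Theorems
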